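import Summits.AtomisticToContinuum.Crystallization.Theorems.PricedLinkCensusLocalToGlobalFccMirrorCandidate
import Summits.AtomisticToContinuum.Crystallization.Theorems.PricedLinkCensusLocalToGlobalFccMirrorLower

/-!
# Mirror exactness of pure confinement at fcc (stub `stub_fccMirrorExact` of line `flux-cell-joint-census`)

Route `PricedLinkCensus`, crux `LocalToGlobal` (stmt-AtomisticToContinuum-14232), line
`flux-cell-joint-census`, registered stub `stub_fccMirrorExact : NewtonShell8 → FccMirrorExact`
(`Theorems/PricedLinkCensusLocalToGlobalDefs`): on an exact fcc patch (an injective configuration coinciding with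
`yᵢ + fcc(a)` within `3ρ₀a` of the site `i`, `ρ₀ ≥ 1`, `a > 0`), the pure-confinement flux cell of the site
(truncated strict Voronoi cell = the open rhombic dodecahedron, smearing radius `nnᵢ/2 = a/2`, zero transfer)
EQUALS the site's `r⁻⁶` lattice sum,

  `fluxCell (cell ρ₀ y i) (y i) (nnᵢ/2) 0 = Σ'_{p ∈ fcc(a) ∖ 0} ‖p‖⁻⁶`  (`= 14.45392… · a⁻⁶`),

the first checkable milestone of the line and the certified sanity check of its flux-tube definitions.

* `≥` is `fccMirror_lowerBound` (`PricedLinkCensusLocalToGlobalFccMirrorLower`): REPLICATION of the cell over boxes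
  of the lattice, the confined Thomson inequality `stub_confinedThomson` at zero transfer, `NewtonShell8` for the
  smeared pair terms, translation covariance, box exhaustion of the lattice sum.
* `≤` (this file, registered sub-goal `fccMirror_upperBound`): THE METHOD OF IMAGES.  By
  `PricedLinkCensusLocalToGlobalFccMirrorCell` the left side is `fluxCell V 0 (a/2) 0` for the canonical cell
  `V = fccVoronoi a`, and `tubeEnergy ≤ ∫‖F*‖²` for the admissible candidate `F* = mirrorFlux a`
  (`PricedLinkCensusLocalToGlobalFccMirrorCandidate`: the field of the infinite lattice of smeared unit charges
  restricted to the tube; tangency at the twelve mirror planes and the wall lemma).  THE ENERGY IDENTITY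
  `∫ ‖F*‖² = (2π⁴)⁻¹ ⨍_{B(0,a/2)} U` (`U = latticePotential a`, `∇U = -2π⁴ latticeField a`): test the weak identity
  of `F*` with `ζ_R U`, `ζ_R` the tree's radial cut-off, and let `R → ∞` — the bulk term converges by dominated
  convergence (`⟪F*, ∇U⟫ = -2π⁴‖F*‖² ∈ L¹`), the cut-off term is `O(∫_{‖z‖ ≥ R} 𝟙_{V×ℝ⁵} (1 + ‖perp z‖)⁻⁶) → 0` by
  the transverse decay of `U` and `latticeField a` on the slab, the source term is eventually constant.  Finally
  `⨍_{B(0,a/2)} U = Σ'_p smearedPair 0 p (a/2) (a/2) = smearedPair 0 0 (a/2) (a/2) + Σ'_{p ≠ 0} ‖p‖⁻⁶` by the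
  HYPOTHESIS `NewtonShell8` (disjoint balls: `a/2 + a/2 ≤ ‖p‖`), so `2π⁴ tubeEnergy - self ≤ S₆`.

References: W. Thomson (Lord Kelvin), method of images (1848); E. H. Lieb, M. Loss, *Analysis* (2001), Thm 9.7,
§11.15; J. H. Conway, N. J. A. Sloane, *Sphere packings, lattices and groups* (1999), Ch. 21; folklore.
-/

noncomputable section

open MeasureTheory Set Filter Metric Topology InnerProductSpace Function Literature.Geometry.DiscreteGeometry
open scoped RealInnerProductSpace BigOperators ENNReal

namespace Summit.AtomisticToContinuum.Crystallization.Theorems.PricedLinkCensusLocalToGlobal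


variable {a : ℝ}

/-! ### The source term: `⨍_{B(0,a/2)} U = self + S₆` -/

/-- One term: `⨍_{B(0,r)} smearedPotential r (z - ι p) dz = smearedPair 0 p r r`. [folklore] -/
theorem setAverage_smearedPotential_sub (r : ℝ) (p : E3) :
    ⨍ z in ball (0 : E8) r, smearedPotential r (z - emb p) = smearedPair 0 p r r := by
  rw [smearedPair, emb_zero]
  refine setAverage_congr_fun measurableSet_ball (Eventually.of_forall fun z _ => ?_)
  rw [smearedPotential]
  have h := setAverage_ball_add_center (fun w => ‖z - w‖⁻¹ ^ 6) 0 (emb p) r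
  rw [zero_add] at h
  rw [h]
  refine setAverage_congr_fun measurableSet_ball (Eventually.of_forall fun w _ => ?_)
  rw [sub_sub]
  abel_nf

/-- The pair terms are bounded by the weights: `|smearedPair 0 p r r| ≤ C (1 + r)⁶ (1 + ‖ι p‖)⁻⁶`. [folklore] -/
theorem abs_smearedPair_le_weight {r : ℝ} (hr : 0 < r) {C : ℝ} (hC0 : 0 ≤ C)
    (hC : ∀ y : E8, |smearedPotential r y| ≤ C * (1 + ‖y‖)⁻¹ ^ 6) (p : E3) :
    |smearedPair 0 p r r| ≤ C * (1 + r) ^ 6 * (1 + ‖emb p‖)⁻¹ ^ 6 := by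
  rw [← setAverage_smearedPotential_sub, ← Real.norm_eq_abs]
  refine norm_setAverage_ball_le hr fun z hz => ?_
  rw [Real.norm_eq_abs]
  refine (hC _).trans ?_
  rw [mul_assoc, ← mul_pow]
  refine mul_le_mul_of_nonneg_left (pow_le_pow_left₀ (by positivity) ?_ 6) hC0
  have := inv_one_add_norm_sub_le (x := emb p) hr.le (le_of_lt (mem_ball_zero_iff.1 hz))
  rwa [norm_sub_rev] at this

/-- **Interchange**: `⨍_{B(0,r)} latticePotential a = Σ'_p smearedPair 0 p r r` (`r = a/2`). [folklore] -/
theorem setAverage_latticePotential_eq_tsum (ha : 0 < a) :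
    ⨍ z in ball (0 : E8) (a / 2), latticePotential a z = ∑' p : fccSet a, smearedPair 0 (p : E3) (a / 2) (a / 2) := by
  haveI : Countable (fccSet a) := countable_fccSet ha.ne'
  set r : ℝ := a / 2 with hr
  have hr0 : 0 < r := half_pos ha
  obtain ⟨C, hC0, hC⟩ := exists_abs_smearedPotential_le_weight hr0
  set T : fccSet a → E8 → ℝ := fun p z => smearedPotential r (z - emb (p : E3)) with hT
  have hTc : ∀ p, Continuous (T p) := fun p =>
    (contDiff_one_smearedPotential r).continuous.comp (continuous_id.sub continuous_const)
  have hTm : ∀ p, AEStronglyMeasurable (T p) (volume.restrict (ball (0 : E8) r)) := fun p => (hTc p).aestronglyMeasurable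
  set b : fccSet a → ℝ := fun p => C * (1 + r) ^ 6 * (1 + ‖emb (p : E3)‖)⁻¹ ^ 6 with hb
  have hbs : Summable b := by
    have h := (summable_weight_fcc8 ha.ne' (by norm_num : 3 < 6) 0).mul_left (C * (1 + r) ^ 6)
    simp only [zero_sub, norm_neg] at h
    exact h
  have hTbd : ∀ p, ∀ z ∈ ball (0 : E8) r, ‖T p z‖ ≤ b p := fun p z hz => by
    rw [Real.norm_eq_abs]
    refine (hC _).trans ?_
    simp only [hb]
    rw [mul_assoc, ← mul_pow]
    refine mul_le_mul_of_nonneg_left (pow_le_pow_left₀ (by positivity) ?_ 6) hC0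
    have := inv_one_add_norm_sub_le (x := emb (p : E3)) hr0.le (le_of_lt (mem_ball_zero_iff.1 hz))
    rwa [norm_sub_rev] at this
  have hTi : ∀ p, IntegrableOn (T p) (ball (0 : E8) r) := fun p =>
    Measure.integrableOn_of_bounded measure_ball_lt_top.ne (hTc p).aestronglyMeasurable
      ((ae_restrict_iff' measurableSet_ball).2 (Eventually.of_forall (hTbd p)))
  -- interchange of sum and integral on the ball
  have hswap : ∫ z in ball (0 : E8) r, ∑' p, T p z = ∑' p, ∫ z in ball (0 : E8) r, T p z := by
    have hle : ∑' p, ∫⁻ z in ball (0 : E8) r, ‖T p z‖ₑ ≤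
        ENNReal.ofReal (∑' p, b p * (volume : Measure E8).real (ball 0 r)) := by
      rw [ENNReal.ofReal_tsum_of_nonneg (fun p => by positivity) (hbs.mul_right _)]
      refine ENNReal.tsum_le_tsum fun p => ?_
      rw [← ofReal_integral_norm_eq_lintegral_enorm (hTi p)]
      refine ENNReal.ofReal_le_ofReal ?_
      calc ∫ z in ball (0 : E8) r, ‖T p z‖ = ‖∫ z in ball (0 : E8) r, ‖T p z‖‖ :=
            (Real.norm_of_nonneg (integral_nonneg fun _ => norm_nonneg _)).symm
        _ ≤ b p * (volume : Measure E8).real (ball 0 r) :=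
            norm_setIntegral_le_of_norm_le_const (measure_ball_lt_top (μ := (volume : Measure E8)))
              fun z hz => by rw [norm_norm]; exact hTbd p z hz
    exact integral_tsum hTm (ne_top_of_le_ne_top ENNReal.ofReal_ne_top hle)
  rw [setAverage_eq, smul_eq_mul, show (fun z => latticePotential a z) = fun z => ∑' p, T p z from rfl, hswap,
    ← tsum_mul_left]
  refine tsum_congr fun p => ?_
  rw [← setAverage_smearedPotential_sub, setAverage_eq, smul_eq_mul]

/-- **The source term** (given `NewtonShell8`, `a > 0`):
`⨍_{B(0,a/2)} latticePotential a = smearedPair 0 0 (a/2) (a/2) + Σ'_{p ∈ fcc(a) ∖ 0} ‖p‖⁻⁶`. [folklore] -/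
theorem setAverage_latticePotential (hN : NewtonShell8) (ha : 0 < a) :
    ⨍ z in ball (0 : E8) (a / 2), latticePotential a z =
      smearedPair 0 0 (a / 2) (a / 2) + ∑' p : {p : E3 // p ∈ fccSet a ∧ p ≠ 0}, ‖(p : E3)‖⁻¹ ^ 6 := by
  classical
  have hr0 : 0 < a / 2 := half_pos ha
  obtain ⟨C, hC0, hC⟩ := exists_abs_smearedPotential_le_weight hr0
  rw [setAverage_latticePotential_eq_tsum ha]
  -- summability of the pair terms
  have hs : Summable fun p : fccSet a => smearedPair 0 (p : E3) (a / 2) (a / 2) := by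
    have h := (summable_weight_fcc8 ha.ne' (by norm_num : 3 < 6) 0).mul_left (C * (1 + a / 2) ^ 6)
    simp only [zero_sub, norm_neg] at h
    exact Summable.of_norm_bounded h fun p => by
      rw [Real.norm_eq_abs]; exact abs_smearedPair_le_weight hr0 hC0 hC _
  rw [hs.tsum_eq_add_tsum_ite ⟨0, zero_mem_fccSet a⟩]
  congr 1
  -- the cross terms are `‖p‖⁻⁶` by `NewtonShell8`
  have h1 : ∑' p : fccSet a, (if p = ⟨0, zero_mem_fccSet a⟩ then 0 else smearedPair 0 (p : E3) (a / 2) (a / 2)) =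
      ∑' p : fccSet a, ‖(p : E3)‖⁻¹ ^ 6 := by
    refine tsum_congr fun p => ?_
    split_ifs with hp
    · rw [hp]; simp
    · have hp0 : (p : E3) ≠ 0 := fun h => hp (Subtype.ext h)
      have hd : a / 2 + a / 2 ≤ dist (0 : E3) (p : E3) := by
        rw [add_halves, dist_eq_norm, zero_sub, norm_neg]
        exact le_norm_of_mem_fccSet p.2 hp0
      rw [hN 0 (p : E3) (a / 2) (a / 2) hr0 hr0 hd, dist_eq_norm, zero_sub, norm_neg]
  rw [h1, ← Equiv.tsum_eq (fccEquiv ha.ne') (fun p : fccSet a => ‖(p : E3)‖⁻¹ ^ 6), tsum_fccSet_eq_tsum_latVec ha.ne']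
  rfl

/-! ### The energy identity of the candidate -/

/-- The gradient of the tree's radial cut-off vanishes inside `B(0, R)` and outside `B̄(0, 2R)`, and is `O(1/R)`. [folklore] -/
theorem norm_gradient_cutoff_le {Cζ R : ℝ} (hC : ∀ R : ℝ, 0 < R → ∀ x : E8, ‖fderiv ℝ (Literature.Analysis.FluidPDE.cutoff R) x‖ ≤ Cζ / R)
    (hR : 0 < R) (z : E8) :
    ‖gradient (Literature.Analysis.FluidPDE.cutoff R) z‖ ≤
      (Icc R (2 * R)).indicator (fun _ => Cζ / R) ‖z‖ := by
  rw [gradient, LinearIsometryEquiv.norm_map]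
  by_cases hz : ‖z‖ ∈ Icc R (2 * R)
  · rw [indicator_of_mem hz]; exact hC R hR z
  · rw [indicator_of_notMem hz]
    rw [mem_Icc, not_and_or, not_le, not_le] at hz
    rcases hz with hlt | hgt
    · have h : Literature.Analysis.FluidPDE.cutoff R =ᶠ[𝓝 z] fun _ => (1 : ℝ) := by
        filter_upwards [(isOpen_lt continuous_norm continuous_const).mem_nhds hlt] with x hx
        exact Literature.Analysis.FluidPDE.cutoff_eq_one hR hx.le
      rw [h.fderiv_eq]; simp
    · have h : Literature.Analysis.FluidPDE.cutoff R =ᶠ[𝓝 z] fun _ => (0 : ℝ) := by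
        filter_upwards [(isOpen_lt continuous_const continuous_norm).mem_nhds hgt] with x hx
        exact Literature.Analysis.FluidPDE.cutoff_eq_zero hR hx.le
      rw [h.fderiv_eq]; simp

/-- The pairing of the candidate with the gradient of its potential is `-2π⁴ ‖F*‖²` pointwise. [folklore] -/
theorem inner_mirrorFlux_gradient_latticePotential (ha : 0 < a) (z : E8) :
    ⟪mirrorFlux a z, gradient (latticePotential a) z⟫ = -(2 * Real.pi ^ 4) * ‖mirrorFlux a z‖ ^ 2 := by
  rw [gradient_latticePotential ha, inner_smul_right, mirrorFlux]
  by_cases hz : z ∈ tube (fccVoronoi a)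
  · rw [indicator_of_mem hz, real_inner_self_eq_norm_sq]
  · rw [indicator_of_notMem hz, inner_zero_left, norm_zero]; ring

/-- **THE ENERGY IDENTITY OF THE CANDIDATE**: `∫ ‖mirrorFlux a‖² = (2π⁴)⁻¹ ⨍_{B(0,a/2)} latticePotential a`
(weak identity tested with `ζ_R · latticePotential a`, `R → ∞`). [cite: LiebLoss2001, §11.15] -/
theorem integral_norm_sq_mirrorFlux (ha : 0 < a) :
    ∫ z, ‖mirrorFlux a z‖ ^ 2 = (2 * Real.pi ^ 4)⁻¹ * ⨍ z in ball (0 : E8) (a / 2), latticePotential a z := by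
  set r : ℝ := a / 2 with hr
  have hr0 : 0 < r := half_pos ha
  set F : E8 → E8 := mirrorFlux a with hF
  set U : E8 → ℝ := latticePotential a with hU
  have hadm := mirrorFlux_mem_admissible ha
  have hF2 : MemLp F 2 volume := hadm.1
  have hFm : AEStronglyMeasurable F volume := hF2.1
  have hU1 : ContDiff ℝ 1 U := contDiff_one_latticePotential ha
  have hUc : Continuous U := hU1.continuous
  obtain ⟨CU, hCU0, hCU⟩ := exists_abs_latticePotential_le_slab ha
  obtain ⟨CF, hCF0, hCF⟩ := exists_norm_latticeField_le_slab ha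
  obtain ⟨Cζ, hCζ0, hCζ⟩ := Literature.Analysis.FluidPDE.exists_norm_fderiv_cutoff_le (E := E8)
  -- the weak identity of the candidate on the whole space, against the ball density
  have hweak : ∀ φ : E8 → ℝ, ContDiff ℝ 1 φ → HasCompactSupport φ →
      ∫ z, ⟪F z, gradient φ z⟫ = -∫ z, ballDensity r z * φ z := fun φ hφ hφc => by
    have h := hadm.2.2 φ ⟨hφ, hφc⟩
    rw [emb_zero] at h
    have h1 : ∫ z, ⟪F z, gradient φ z⟫ = ∫ z in tube (fccVoronoi a), ⟪F z - 0, gradient φ z⟫ := by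
      rw [← setIntegral_eq_integral_of_forall_compl_eq_zero (s := tube (fccVoronoi a)) fun z hz => ?_]
      · exact integral_congr_ae (Eventually.of_forall fun z => by simp only [sub_zero])
      · have h0 : F z = 0 := hadm.2.1 z hz
        rw [h0, inner_zero_left]
    rw [h1, h, ← integral_ballDensity_smul]
    rfl
  -- the energy integrand
  have hsq : Integrable fun z => ‖F z‖ ^ 2 := (memLp_two_iff_integrable_sq_norm hFm).1 hF2
  have hpair : ∀ z, ⟪F z, gradient U z⟫ = -(2 * Real.pi ^ 4) * ‖F z‖ ^ 2 := inner_mirrorFlux_gradient_latticePotential ha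
  have hIpair : Integrable fun z => ⟪F z, gradient U z⟫ := by
    simp_rw [hpair]; exact hsq.const_mul _
  -- the cut-offs
  set ζ : ℕ → E8 → ℝ := fun n => Literature.Analysis.FluidPDE.cutoff ((n : ℝ) + 1) with hζ
  have hRpos : ∀ n : ℕ, (0 : ℝ) < (n : ℝ) + 1 := fun n => by positivity
  have hζ1 : ∀ n, ContDiff ℝ 1 (ζ n) := fun n => Literature.Analysis.FluidPDE.contDiff_cutoff _
  have hζc : ∀ n, HasCompactSupport (ζ n) := fun n => Literature.Analysis.FluidPDE.hasCompactSupport_cutoff (hRpos n)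
  have hζle : ∀ n z, |ζ n z| ≤ 1 := fun n z => Literature.Analysis.FluidPDE.abs_cutoff_le_one _ _
  have hζlim : ∀ z, Tendsto (fun n => ζ n z) atTop (𝓝 1) := fun z =>
    Literature.Analysis.FluidPDE.tendsto_cutoff_natCast_add_one z
  have hζgrad : ∀ n z, ‖gradient (ζ n) z‖ ≤ (Icc ((n : ℝ) + 1) (2 * ((n : ℝ) + 1))).indicator
      (fun _ => Cζ / ((n : ℝ) + 1)) ‖z‖ := fun n z => norm_gradient_cutoff_le hCζ (hRpos n) z
  -- the tested identities
  have hI1 : ∀ n, Integrable fun z => ζ n z * ⟪F z, gradient U z⟫ := fun n =>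
    hIpair.bdd_mul (hζ1 n).continuous.aestronglyMeasurable (c := 1) (Eventually.of_forall fun z => by
      rw [Real.norm_eq_abs]; exact hζle n z)
  -- the majorant of the cut-off terms
  set G : ℕ → E8 → ℝ := fun n z => (Ici ((n : ℝ) + 1)).indicator (fun _ => (1 : ℝ)) ‖z‖ *
    ((ball (0 : E3) a).indicator (fun _ => 3 * Cζ * CU * CF) (proj z) * (1 + ‖perpL z‖) ^ (-(6 : ℝ))) with hG
  have hslab := integrable_slab_weight (0 : E3) a (3 * Cζ * CU * CF) (by norm_num : (5 : ℝ) < 6)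
  have hind1 : ∀ (n : ℕ) (z : E8), ‖(Ici ((n : ℝ) + 1)).indicator (fun _ => (1 : ℝ)) ‖z‖‖ ≤ 1 := fun n z => by
    rw [Real.norm_eq_abs]
    by_cases h : ‖z‖ ∈ Ici ((n : ℝ) + 1)
    · rw [indicator_of_mem h, abs_one]
    · rw [indicator_of_notMem h, abs_zero]; exact zero_le_one
  have hGi : ∀ n, Integrable (G n) := fun n =>
    hslab.bdd_mul ((measurable_const.indicator measurableSet_Ici).comp continuous_norm.measurable).aestronglyMeasurable
      (Eventually.of_forall (hind1 n))
  have hGlim : Tendsto (fun n => ∫ z, G n z) atTop (𝓝 0) := by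
    have h := tendsto_integral_of_dominated_convergence (fun z => ‖(ball (0 : E3) a).indicator
        (fun _ => 3 * Cζ * CU * CF) (proj z) * (1 + ‖perpL z‖) ^ (-(6 : ℝ))‖)
      (fun n => (hGi n).aestronglyMeasurable) hslab.norm (fun n => Eventually.of_forall fun z => ?_)
      (Eventually.of_forall fun z => ?_) (F := G) (f := fun _ => 0)
    · rwa [integral_zero] at h
    · rw [hG]; simp only
      rw [norm_mul]
      exact mul_le_of_le_one_left (norm_nonneg _) (hind1 n z)
    · refine tendsto_const_nhds.congr' ?_
      obtain ⟨N, hN⟩ := exists_nat_gt ‖z‖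
      filter_upwards [eventually_ge_atTop N] with n hn
      have hnot : ‖z‖ ∉ Ici ((n : ℝ) + 1) := by
        rw [mem_Ici, not_le]
        have : (N : ℝ) ≤ n := by exact_mod_cast hn
        linarith
      rw [hG]; simp only
      rw [indicator_of_notMem hnot, zero_mul]
  -- pointwise domination of the cut-off terms
  have hdom : ∀ n z, ‖U z * ⟪F z, gradient (ζ n) z⟫‖ ≤ G n z := fun n z => by
    by_cases hz : z ∈ tube (fccVoronoi a)
    · have hpz : ‖proj z‖ < a := norm_lt_of_mem_fccVoronoi ha hz
      have hpz' : proj z ∈ ball (0 : E3) a := mem_ball_zero_iff.2 hpz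
      rw [hG]; simp only
      rw [indicator_of_mem hpz']
      by_cases hzn : ‖z‖ ∈ Icc ((n : ℝ) + 1) (2 * ((n : ℝ) + 1))
      · have hzn' : ‖z‖ ∈ Ici ((n : ℝ) + 1) := hzn.1
        rw [indicator_of_mem hzn', one_mul, norm_mul, Real.norm_eq_abs]
        have hFz : ‖F z‖ ≤ CF * (1 + ‖perpL z‖)⁻¹ ^ 3 := by
          rw [hF, mirrorFlux, indicator_of_mem hz]; exact hCF z hpz.le
        have hUz : |U z| ≤ CU * (1 + ‖perpL z‖)⁻¹ ^ 2 := hCU z hpz.le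
        have hgz : ‖gradient (ζ n) z‖ ≤ Cζ / ((n : ℝ) + 1) := by
          have := hζgrad n z; rwa [indicator_of_mem hzn] at this
        -- `t ≥ ‖z‖ - a ≥ (n+1) - a` and `t ≤ ‖z‖ ≤ 2(n+1)`, so `(1+t)⁻⁵/(n+1) ≤ 3 (1+t)⁻⁶`
        set t : ℝ := ‖perpL z‖ with ht
        have ht0 : 0 ≤ t := norm_nonneg _
        have htle : t ≤ 2 * ((n : ℝ) + 1) := (norm_perpL_le z).trans hzn.2
        have hkey : (1 + t)⁻¹ ^ 5 * (Cζ / ((n : ℝ) + 1)) ≤ 3 * Cζ * (1 + t) ^ (-(6 : ℝ)) := by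
          rw [show (1 + t) ^ (-(6 : ℝ)) = (1 + t)⁻¹ ^ 6 by
            rw [Real.rpow_neg (by positivity), show ((6 : ℝ)) = ((6 : ℕ) : ℝ) by norm_num, Real.rpow_natCast, inv_pow]]
          have hn0 : (0 : ℝ) ≤ n := n.cast_nonneg
          have h1 : (1 : ℝ) / ((n : ℝ) + 1) ≤ 3 * (1 + t)⁻¹ := by
            rw [div_le_iff₀ (hRpos n), show 3 * (1 + t)⁻¹ * ((n : ℝ) + 1) = 3 * ((n : ℝ) + 1) / (1 + t) by ring,
              le_div_iff₀ (by positivity : (0 : ℝ) < 1 + t)]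
            nlinarith [htle]
          calc (1 + t)⁻¹ ^ 5 * (Cζ / ((n : ℝ) + 1)) = Cζ * ((1 + t)⁻¹ ^ 5 * (1 / ((n : ℝ) + 1))) := by ring
            _ ≤ Cζ * ((1 + t)⁻¹ ^ 5 * (3 * (1 + t)⁻¹)) :=
                mul_le_mul_of_nonneg_left (mul_le_mul_of_nonneg_left h1 (by positivity)) hCζ0
            _ = 3 * Cζ * (1 + t)⁻¹ ^ 6 := by ring
        calc |U z| * ‖⟪F z, gradient (ζ n) z⟫‖ ≤ |U z| * (‖F z‖ * ‖gradient (ζ n) z‖) :=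
              mul_le_mul_of_nonneg_left (by rw [Real.norm_eq_abs]; exact abs_real_inner_le_norm _ _) (abs_nonneg _)
          _ ≤ CU * (1 + t)⁻¹ ^ 2 * (CF * (1 + t)⁻¹ ^ 3 * (Cζ / ((n : ℝ) + 1))) :=
              mul_le_mul hUz (mul_le_mul hFz hgz (norm_nonneg _) (by positivity)) (by positivity) (by positivity)
          _ = CU * CF * ((1 + t)⁻¹ ^ 5 * (Cζ / ((n : ℝ) + 1))) := by ring
          _ ≤ CU * CF * (3 * Cζ * (1 + t) ^ (-(6 : ℝ))) := mul_le_mul_of_nonneg_left hkey (by positivity)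
          _ = 3 * Cζ * CU * CF * (1 + t) ^ (-(6 : ℝ)) := by ring
      · have hg0 : gradient (ζ n) z = 0 := by
          have := hζgrad n z; rw [indicator_of_notMem hzn] at this; exact norm_le_zero_iff.1 this
        rw [hg0, inner_zero_right, mul_zero, norm_zero]
        exact mul_nonneg (indicator_nonneg (fun _ _ => zero_le_one) _) (mul_nonneg (by positivity) (by positivity))
    · have hF0 : F z = 0 := by rw [hF, mirrorFlux, indicator_of_notMem hz]
      rw [hF0, inner_zero_left, mul_zero, norm_zero]
      rw [hG]; simp only
      exact mul_nonneg (indicator_nonneg (fun _ _ => zero_le_one) _)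
        (mul_nonneg (indicator_nonneg (fun _ _ => by positivity) _) (by positivity))
  have hI2 : ∀ n, Integrable fun z => U z * ⟪F z, gradient (ζ n) z⟫ := fun n =>
    (hGi n).mono' (hUc.aestronglyMeasurable.mul (hFm.inner
      (Literature.Analysis.FluidPDE.continuous_gradient_of_contDiff (hζ1 n)).aestronglyMeasurable))
      (Eventually.of_forall (hdom n))
  have hid : ∀ n, (∫ z, ζ n z * ⟪F z, gradient U z⟫) + ∫ z, U z * ⟪F z, gradient (ζ n) z⟫ =
      -∫ z, ballDensity r z * (ζ n z * U z) := fun n => by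
    rw [← hweak _ ((hζ1 n).mul hU1) ((hζc n).mul_right), ← integral_add (hI1 n) (hI2 n)]
    refine integral_congr_ae (Eventually.of_forall fun z => ?_)
    exact (inner_gradient_mul_apply ((hζ1 n).differentiable one_ne_zero z) (hU1.differentiable one_ne_zero z) (F z)).symm
  -- limits
  have hL1 : Tendsto (fun n => ∫ z, ζ n z * ⟪F z, gradient U z⟫) atTop (𝓝 (∫ z, ⟪F z, gradient U z⟫)) := by
    refine tendsto_integral_of_dominated_convergence (fun z => ‖⟪F z, gradient U z⟫‖) (fun n => (hI1 n).aestronglyMeasurable)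
      hIpair.norm (fun n => Eventually.of_forall fun z => ?_) (Eventually.of_forall fun z => ?_)
    · rw [norm_mul, Real.norm_eq_abs]
      exact mul_le_of_le_one_left (norm_nonneg _) (hζle n z)
    · simpa using (hζlim z).mul_const ⟪F z, gradient U z⟫
  have hL2 : Tendsto (fun n => ∫ z, U z * ⟪F z, gradient (ζ n) z⟫) atTop (𝓝 0) :=
    squeeze_zero_norm (fun n => (norm_integral_le_integral_norm _).trans (integral_mono (hI2 n).norm (hGi n) (hdom n))) hGlim
  have hL3 : Tendsto (fun n => -∫ z, ballDensity r z * (ζ n z * U z)) atTop (𝓝 (-∫ z, ballDensity r z * U z)) := by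
    refine (tendsto_const_nhds.congr' ?_).neg
    obtain ⟨N, hN⟩ := exists_nat_gt r
    filter_upwards [eventually_ge_atTop N] with n hn
    refine integral_congr_ae (Eventually.of_forall fun z => ?_)
    simp only
    by_cases hz : r < ‖z‖
    · rw [ballDensity_eq_zero hz, zero_mul, zero_mul]
    · rw [hζ]; simp only
      rw [Literature.Analysis.FluidPDE.cutoff_eq_one (hRpos n) ?_, one_mul]
      have : (N : ℝ) ≤ n := by exact_mod_cast hn
      linarith [not_lt.1 hz]
  have hlim := tendsto_nhds_unique ((hL1.add hL2).congr fun n => hid n) hL3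
  have hρU : ∫ z, ballDensity r z * U z = ⨍ z in ball (0 : E8) r, U z := integral_ballDensity_smul U
  rw [add_zero, hρU] at hlim
  -- conclude
  have hval : ∫ z, ⟪F z, gradient U z⟫ = -(2 * Real.pi ^ 4) * ∫ z, ‖F z‖ ^ 2 := by
    rw [← integral_const_mul]; exact integral_congr_ae (Eventually.of_forall hpair)
  rw [hval] at hlim
  have hπ : (2 * Real.pi ^ 4) ≠ 0 := by positivity
  have h2 : ∫ z, ‖F z‖ ^ 2 = (2 * Real.pi ^ 4)⁻¹ * ⨍ z in ball (0 : E8) r, U z := by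
    have : (2 * Real.pi ^ 4) * ∫ z, ‖F z‖ ^ 2 = ⨍ z in ball (0 : E8) r, U z := by linarith
    rw [← this, ← mul_assoc, inv_mul_cancel₀ hπ, one_mul]
  exact h2

/-! ### The upper bound -/

/-- **`fluxCell V 0 (a/2) 0 ≤ S₆(a)`** for the canonical cell (given `NewtonShell8`). [folklore] -/
theorem fluxCell_fccVoronoi_le (hN : NewtonShell8) (ha : 0 < a) :
    fluxCell (fccVoronoi a) 0 (a / 2) (fun _ => 0) ≤ ∑' p : {p : E3 // p ∈ fccSet a ∧ p ≠ 0}, ‖(p : E3)‖⁻¹ ^ 6 := by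
  have hE : tubeEnergy (fccVoronoi a) 0 (a / 2) (fun _ => 0) ≤ ∫ z, ‖mirrorFlux a z‖ ^ 2 := by
    refine csInf_le ⟨0, ?_⟩ ⟨mirrorFlux a, mirrorFlux_mem_admissible ha, rfl⟩
    rintro _ ⟨G, -, rfl⟩
    exact integral_nonneg fun _ => by positivity
  rw [integral_norm_sq_mirrorFlux ha, setAverage_latticePotential hN ha] at hE
  rw [fluxCell]
  have hπ : 0 < 2 * Real.pi ^ 4 := by positivity
  have h := mul_le_mul_of_nonneg_left hE hπ.le
  rw [← mul_assoc, mul_inv_cancel₀ hπ.ne', one_mul] at h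
  linarith

/-- **Registered sub-goal `fccMirror_upperBound`** (line `flux-cell-joint-census`, second half of
`stub_fccMirrorExact`): on an exact fcc patch, given `NewtonShell8`, the pure-confinement flux cell is AT MOST the
site's `r⁻⁶` lattice sum (the method of images supplies an admissible flux of exactly that energy). [folklore] -/
theorem fccMirror_upperBound : ∀ (a ρ₀ : ℝ), 0 < a → 1 ≤ ρ₀ → ∀ (N : ℕ) (y : Fin N → E3) (i : Fin N),
    Function.Injective y → (∀ j, dist (y j) (y i) ≤ 3 * ρ₀ * a → y j - y i ∈ fccSet a) →
    (∀ p ∈ fccSet a, ‖p‖ ≤ 3 * ρ₀ * a → ∃ j, y j = y i + p) → NewtonShell8 →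
    fluxCell (cell ρ₀ y i) (y i) (nearestDist y i / 2) (fun _ => 0) ≤
      ∑' p : {p : E3 // p ∈ fccSet a ∧ p ≠ 0}, ‖(p : E3)‖⁻¹ ^ 6 := by
  intro a ρ₀ ha hρ₀ N y i hy h1 h2 hN
  rw [nearestDist_eq_of_fcc ha hρ₀ hy h1 h2, fluxCell_eq_canonical ha hρ₀ hy h1 h2]
  exact fluxCell_fccVoronoi_le hN ha

/-! ### The stub -/

/-- **Registered stub `stub_fccMirrorExact` (mirror exactness of pure confinement at fcc).** Given Newton's
shell theorem in `ℝ⁸`, on an exact fcc patch the pure-confinement flux cell of a site equals exactly the site's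
`r⁻⁶` lattice sum `Σ'_{p ∈ fcc(a) ∖ 0} ‖p‖⁻⁶`: the lower bound by replication and the confined Thomson
inequality, the upper bound by the method of images. [cite: LiebLoss2001, §11.15] -/
theorem stub_fccMirrorExact : NewtonShell8 → FccMirrorExact :=
  fun hN a ρ₀ ha hρ₀ N y i hy h1 h2 =>
    le_antisymm (fccMirror_upperBound a ρ₀ ha hρ₀ N y i hy h1 h2 hN)
      (fccMirror_lowerBound a ρ₀ ha hρ₀ N y i hy h1 h2 hN stub_confinedThomson)

end Summit.AtomisticToContinuum.Crystallization.Theorems.PricedLinkCensusLocalToGlobal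

end
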